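import Summits.QuantumFields.BalabanUV.T4Continuum.Spine.NE3.TangentProjectionSlicB8
import Summits.QuantumFields.BalabanUV.T4Continuum.Support.NE3HodgeCoexactPoincareEnd
import Summits.QuantumFields.BalabanUV.T4Continuum.Support.NE3FrameFreeSliceUnique
import Summits.QuantumFields.BalabanUV.T4Continuum.Support.NE3FlatHessianCurl
import Summits.QuantumFields.BalabanUV.T4Continuum.Support.NE3ClassRadiusFamily
import HarnessLib

/-!
# T⁴ programme, node NE3 — census R32 (first half): AT THE FLAT BACKGROUND THE CO-CLOSED HODGE COMPONENT OF A DIRECTION IN THE KERNEL OF THE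
# k-FOLD DOUBLE-BAR AVERAGE IS CONTROLLED BY THE FLAT CURL — N-FREE, k-FREE (constant `9·(L^{j+1})²` in the weighted currency `9`)

Cell `pub-balaban-gaps` (track G2, seat `ne3`; writer prover-pub-balaban-gaps-ne3-g5-0, 2026-08-23), census `run/shared/lean/pub/pub-balaban-gaps/ne/NE3.md` §4 R32 ∕ §11.
WHAT.  (P♮) on B8's slice `slicB8` at the flat background for a GENERAL coarse torus size `N` (census R32) splits along the flat Hodge decomposition
`Y = (Y − dPot ζ₀) + dPot ζ₀` into a co-closed half and a (1.38)-exact half.  THIS FILE settles the co-closed half for every `N ≥ 1`, WITHOUT the Landau clause: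
**`sum_nhsNormSq_coclosed_le_curl_of_QbarIter_flatCfg`** — for `L ≥ 2`, `N ≥ 1`, a skew `(N·L^{j+1})`-periodic `Y` with `QbarIter L (j+1) flatCfg Y = 0` and any periodic
`ζ₀` with `flatDiv (Y − dPot ζ₀) = 0`: `Σ_{periodBox (N·L^{j+1})} Σ_κ nhsNormSq (Y − dPot ζ₀) ≤ 9·(L^{j+1})²·Σ Σ_π nhsNormSq (curlAt flatCfg Y)` — N-FREE, k-free in the
weighted currency.  MECHANISM: R25's corner spike `ζ` of the accumulated frames turns `Y` into the plain-fibre tangent direction `Y′ = Y + dPot ζ` with the same flat curl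
(`tangentIter_sub_gaugeDir_of_QbarIter_eq_zero`, `curlAt_flatCfg_coexact`); `Y′ − dPot (ζ₀ + ζ) = Y − dPot ζ₀` is co-closed, and the tree's block-Poincaré of the co-closed
component of a flat tangent direction (`NE3HodgeCoexactPoincareEnd.sum_nhsNormSq_coexact_le_curl`) is the claim.  What remains of R32 is the EXACT half: the (1.38)-Landau
potential is the `Δ²`-minimal extension of its block means (census R32: C¹ block-mean interpolant + torus gap, M–L); at `N = 1` it vanishes (`SlicePoincareSlicB8Flat`).

CONTENT (0 sorry, no `def`): **`sum_nhsNormSq_coclosed_le_curl_of_QbarIter_flatCfg`** [folklore].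

HONEST FRAMING.  Kinematics of OUR slice at the TRIVIAL background; nothing about curved backgrounds or Bałaban's minimisers; (P♮) on `slicB8` at `W = cavg L U_B`
stays the printed-TYPE hypothesis of THE END; **NE3 is NOT proved**; spine PROVED 0∕9; finite T⁴ rung (B)+1 — NOT continuum YM on ℝ⁴, NOT infinite volume, NOT mass gap,
NOT Clay.  PLACEMENT: `Summits/QuantumFields/BalabanUV/T4Continuum/Spine/NE3/`.
-/

set_option autoImplicit false

open scoped BigOperators Matrix Matrix.Norms.L2Operator
open Finset

namespace Summit.QuantumFields.BalabanUV.T4Continuum.NE3.SlicB8FlatCoexact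

open Literature.MathematicalPhysics.QuantumFieldTheory.Balaban1983to89
open B7Prop1Explicit B7Prop2Explicit
open T4AveragingDeficitWall (IsUnitaryCfg IsSkewDir SmallField Ad Plane curlAt curlSq dirSq)
open T4AveragingDeficitWallBoundary (IsPeriodicCfg periodBox mem_periodBox)
open AveragingDeficitPeriodicCounting (IsPeriodicDir)
open AveragingDeficitMultiLevelPrep (TangentIter tower LevelSmall)
open AveragingDeficitTwoLevelPrep (prop1Radius twoLevelSmall)
open SpreadLift (loopRad)
open BlockAveragePushDirGauge (gaugeDir isPeriodicDir_gaugeDir)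
open BlockAveragePushDirSplit (flat)
open MinimalActionWitness (flatCfg isPeriodicCfg_flatCfg)
open NE3TangentCovariantTower (QbarIter framePotW)
open NE3CurvedFrameKill (framePotW_skew_periodic)
open NE3FramePotBoundW (tower_eq_pow_mul)
open NE3TangentNoGoWords (dPot)
open NE3CoercivityScaling (flatDiv)
open MatrixNorms (nhsNormSq nhsNormSq_nonneg)
open NE3FrameFreeSliceUnique (gaugeDir_flatCfg_eq_neg_dPot)
open NE3FlatHessianCurl (isUnitaryCfg_flatCfg smallField_flatCfg_zero)
open NE3ClassRadiusFamily (levelSmall_of_small)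
open NE3HodgeCoexactPoincareEnd (sum_nhsNormSq_coexact_le_curl curlAt_flatCfg_coexact)
open NE3.TangentProjectionSlicB8 (tangentIter_sub_gaugeDir_of_QbarIter_eq_zero)

noncomputable section

variable {d : ℕ} {n : Type*} [Fintype n] [DecidableEq n]

/-- **THE CO-CLOSED HALF OF (P♮) ON `slicB8` AT THE FLAT BACKGROUND, EVERY `N`** (module docstring): for `Y ∈ ker QbarIter L (j+1) 1` (skew, `(N·L^{j+1})`-periodic) and
any periodic flat Hodge potential `ζ₀` (`flatDiv (Y − dPot ζ₀) = 0`),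
`Σ nhsNormSq (Y − dPot ζ₀) ≤ 9·(L^{j+1})²·Σ_π nhsNormSq (curlAt 1 Y)` over `periodBox (N·L^{j+1})`. [folklore] -/
theorem sum_nhsNormSq_coclosed_le_curl_of_QbarIter_flatCfg [Nonempty n] {L N : ℕ} [NeZero N] (hL : 2 ≤ L) (hN : 1 ≤ N) (j : ℕ)
    {Y : Site d → Fin d → Matrix n n ℂ} (hYs : IsSkewDir Y) (hYP : IsPeriodicDir Y ((N * L ^ (j + 1) : ℕ) : ℤ))
    (hQ : QbarIter L (j + 1) (flatCfg : Site d → Fin d → (Matrix n n ℂ)ˣ) Y = fun _ _ => 0)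
    {ζ₀ : Site d → Matrix n n ℂ} (hζ₀P : ∀ (x : Site d) (τ : Fin d), ζ₀ (x + ((N * L ^ (j + 1) : ℕ) : ℤ) • e τ) = ζ₀ x)
    (hdiv₀ : ∀ x : Site d, flatDiv (fun y μ => Y y μ - dPot ζ₀ y μ) x = 0) :
    ∑ x ∈ periodBox (d := d) (N * L ^ (j + 1)), ∑ κ : Fin d, nhsNormSq (Y x κ - dPot ζ₀ x κ)
      ≤ 9 * ((L : ℝ) ^ (j + 1)) ^ 2
          * ∑ x ∈ periodBox (d := d) (N * L ^ (j + 1)), ∑ π : Plane d,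
              nhsNormSq (curlAt (flatCfg (d := d) (n := n)) Y x π.1.1 π.1.2) := by
  have hL1 : 1 ≤ L := le_trans (by norm_num) hL
  set M : ℕ := L ^ (j + 1) with hM
  have hMpos : 0 < M := by rw [hM]; positivity
  have hM0 : (M : ℤ) ≠ 0 := by exact_mod_cast hMpos.ne'
  have hMZ : ((M : ℕ) : ℤ) = (L : ℤ) ^ (j + 1) := by rw [hM]; push_cast; rfl
  have hPM : N * L ^ (j + 1) = M * N := by rw [hM, Nat.mul_comm]
  have htower : tower L N (j + 1) = M * N := by rw [tower_eq_pow_mul]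
  have hWu : IsUnitaryCfg (flatCfg : Site d → Fin d → (Matrix n n ℂ)ˣ) := isUnitaryCfg_flatCfg
  have hWP_T : IsPeriodicCfg (flatCfg : Site d → Fin d → (Matrix n n ℂ)ˣ) ((tower L N (j + 1) : ℕ) : ℤ) := isPeriodicCfg_flatCfg _
  have hWP_M : IsPeriodicCfg (flatCfg : Site d → Fin d → (Matrix n n ℂ)ˣ) ((N * L ^ (j + 1) : ℕ) : ℤ) := isPeriodicCfg_flatCfg _
  have hYP_T : IsPeriodicDir Y ((tower L N (j + 1) : ℕ) : ℤ) := by rw [htower, ← hPM]; exact hYP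
  have hs0 : LevelSmall d L j 0 := levelSmall_of_small hL j le_rfl (by simp) (by simp)
  -- the accumulated frames and their corner spike (as in `TangentProjectionSlicB8`)
  obtain ⟨hfs, hfP⟩ := framePotW_skew_periodic (M := N) hL1 j hWu hWP_T le_rfl hs0 smallField_flatCfg_zero hYs hYP_T
  set f : Site d → Matrix n n ℂ := framePotW L (j + 1) (flatCfg : Site d → Fin d → (Matrix n n ℂ)ˣ) Y with hf
  set ζ : Site d → Matrix n n ℂ := fun y => if (∀ i, (M : ℤ) ∣ y i) then f (fun i => y i / (M : ℤ)) else 0 with hζ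
  have hζ_of : ∀ y : Site d, (∀ i, (M : ℤ) ∣ y i) → ζ y = f (fun i => y i / (M : ℤ)) := fun y h => by
    simp only [hζ, if_pos h]
  have hζ_off : ∀ y : Site d, ¬ (∀ i, (M : ℤ) ∣ y i) → ζ y = 0 := fun y h => by
    simp only [hζ, if_neg h]
  have hcorner' : ∀ z : Site d, ζ (((L : ℤ) ^ (j + 1)) • z) = framePotW L (j + 1) (flatCfg : Site d → Fin d → (Matrix n n ℂ)ˣ) Y z := by
    intro z
    have hdiv : ∀ i, (M : ℤ) ∣ ((M : ℤ) • z) i := fun i => by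
      simp only [Pi.smul_apply, smul_eq_mul]; exact dvd_mul_right _ _
    rw [← hMZ, hζ_of _ hdiv]
    show f _ = f z
    congr 1
    funext i
    simp only [Pi.smul_apply, smul_eq_mul]
    exact Int.mul_ediv_cancel_left _ hM0
  have hζs : ∀ y, ζ y ∈ skewAdjoint (Matrix n n ℂ) := by
    intro y
    by_cases hdiv : ∀ i, (M : ℤ) ∣ y i
    · rw [hζ_of y hdiv]; exact hfs _
    · rw [hζ_off y hdiv]; exact (skewAdjoint (Matrix n n ℂ)).zero_mem
  have hζP : ∀ (y : Site d) (i : Fin d), ζ (y + ((M * N : ℕ) : ℤ) • e i) = ζ y := by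
    intro y i
    have hcoord : ∀ k : Fin d, (y + ((M * N : ℕ) : ℤ) • e i) k = y k + (M : ℤ) * ((N : ℤ) * e i k) := by
      intro k; simp only [Pi.add_apply, Pi.smul_apply, smul_eq_mul]; push_cast; ring
    have hdiv_iff : (∀ k, (M : ℤ) ∣ (y + ((M * N : ℕ) : ℤ) • e i) k) ↔ ∀ k, (M : ℤ) ∣ y k := by
      refine forall_congr' fun k => ?_
      rw [hcoord]
      constructor
      · intro h
        have h' := dvd_sub h (dvd_mul_right (M : ℤ) ((N : ℤ) * e i k))
        rwa [add_sub_cancel_right] at h'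
      · intro h
        exact dvd_add h (dvd_mul_right _ _)
    by_cases hdiv : ∀ k, (M : ℤ) ∣ y k
    · rw [hζ_of _ (hdiv_iff.mpr hdiv), hζ_of _ hdiv]
      have hq : (fun k => (y + ((M * N : ℕ) : ℤ) • e i) k / (M : ℤ)) = (fun k => y k / (M : ℤ)) + (N : ℤ) • e i := by
        funext k
        rw [hcoord, Int.add_mul_ediv_left _ _ hM0]
        simp only [Pi.add_apply, Pi.smul_apply, smul_eq_mul]
      rw [hq, hfP]
    · rw [hζ_off _ hdiv, hζ_off _ (fun h => hdiv (hdiv_iff.mp h))]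
  have hζP_T : ∀ (y : Site d) (i : Fin d), ζ (y + ((tower L N (j + 1) : ℕ) : ℤ) • e i) = ζ y := by
    rw [htower]; exact hζP
  have hζP_P : ∀ (y : Site d) (i : Fin d), ζ (y + ((N * L ^ (j + 1) : ℕ) : ℤ) • e i) = ζ y := by
    rw [hPM]; exact hζP
  -- the plain-fibre tangent representative `Y′ = Y − gaugeDir 1 ζ = Y + dPot ζ`
  have hT := tangentIter_sub_gaugeDir_of_QbarIter_eq_zero (N := N) hL1 j hWu hWP_T le_rfl hs0 smallField_flatCfg_zero hYs hYP_T
    hQ hζs hζP_T hcorner'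
  set Y' : Site d → Fin d → Matrix n n ℂ := fun y κ => Y y κ - dPot (fun y => -ζ y) y κ with hY'
  have hY'eq : Y - gaugeDir (flatCfg : Site d → Fin d → (Matrix n n ℂ)ˣ) ζ = Y' := by
    funext y κ
    simp only [hY', Pi.sub_apply, gaugeDir_flatCfg_eq_neg_dPot, dPot]
    abel
  have hT' : TangentIter L j (flat (d := d) (n := n)) Y' := by
    rw [← hY'eq]; exact hT
  have hY'P : IsPeriodicDir Y' ((N * L ^ (j + 1) : ℕ) : ℤ) := by
    rw [← hY'eq]
    intro y τ μ
    have h1 : Y (y + ((N * L ^ (j + 1) : ℕ) : ℤ) • e τ) μ = Y y μ := hYP y τ μ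
    have h2 := isPeriodicDir_gaugeDir hWP_M hζP_P y τ μ
    simp only [Pi.sub_apply, h1, h2]
  -- `Y′ − dPot (ζ₀ + ζ) = Y − dPot ζ₀`
  have hY'sub : ∀ (y : Site d) (κ : Fin d), Y' y κ - dPot (fun y => ζ₀ y + ζ y) y κ = Y y κ - dPot ζ₀ y κ := by
    intro y κ
    simp only [hY', dPot]
    abel
  have hζsumP : ∀ (x : Site d) (τ : Fin d), (fun y => ζ₀ y + ζ y) (x + ((N * L ^ (j + 1) : ℕ) : ℤ) • e τ) = (fun y => ζ₀ y + ζ y) x := by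
    intro x τ
    have h1 : ζ₀ (x + ((N * L ^ (j + 1) : ℕ) : ℤ) • e τ) = ζ₀ x := hζ₀P x τ
    simp only [h1, hζP_P x τ]
  have hdiv : ∀ x : Site d, flatDiv (fun y μ => Y' y μ - dPot (fun y => ζ₀ y + ζ y) y μ) x = 0 := by
    intro x
    have hfun : (fun y μ => Y' y μ - dPot (fun y => ζ₀ y + ζ y) y μ) = fun y μ => Y y μ - dPot ζ₀ y μ := by
      funext y μ; exact hY'sub y μ
    rw [hfun]
    exact hdiv₀ x
  have h := sum_nhsNormSq_coexact_le_curl hL1 hN hY'P hT' hζsumP hdiv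
  have hlhs : ∑ x ∈ periodBox (d := d) (N * L ^ (j + 1)), ∑ κ : Fin d, nhsNormSq (Y' x κ - dPot (fun y => ζ₀ y + ζ y) x κ)
      = ∑ x ∈ periodBox (d := d) (N * L ^ (j + 1)), ∑ κ : Fin d, nhsNormSq (Y x κ - dPot ζ₀ x κ) :=
    Finset.sum_congr rfl fun x _ => Finset.sum_congr rfl fun κ _ => by rw [hY'sub]
  have hcurl : ∀ (x : Site d) (π : Plane d),
      curlAt (flatCfg (d := d) (n := n)) Y' x π.1.1 π.1.2 = curlAt (flatCfg (d := d) (n := n)) Y x π.1.1 π.1.2 :=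
    fun x π => curlAt_flatCfg_coexact Y (fun y => -ζ y) x π.1.1 π.1.2
  rw [hlhs] at h
  simp_rw [hcurl] at h
  exact h

end

end Summit.QuantumFields.BalabanUV.T4Continuum.NE3.SlicB8FlatCoexact
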